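import Summits.QuantumFields.BalabanUV.T4Continuum.Support.NE7LoewnerDiagramBV
import Summits.QuantumFields.BalabanUV.Beta.GAN24.MonotoneTorusPlaquette
import Summits.QuantumFields.BalabanUV.Beta.GAN24.MonotoneTorusSoft

/-!
# NE7LoewnerDiagramPlaquette — row NE7 (node U5), route «PAIR-CAUCHY» ∕ supplier LÖW (ROUTES-NE7.md §L2.2 B3, wiring
# question W-LÖW-g4-1, CO-EXACT FACE): the diagram-BV lemma INSTANTIATED on the UNCONDITIONAL Löwner chain of the torus
# PLAQUETTE COVARIANCES of Bałaban's block-constrained `U = 1` fluctuation field (`GAN24/MonotoneTorusPlaquette.plaqCov`) —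
# every diagram functional of them converges under refinement, with an explicit total variation, a null tail modulus
# (no rate), and a BAND FROM ONE TRACE DATUM

Cell `pub-balaban`, rung (B)+1 sub-cell t4, lineage `b2b-balaban-t4-ne7-p2` (CRUX PROVER NE7 #2 under the
coordinator ruling «YM redirect», 2026-08-21; generation 53; route texts `HOME/t4/ROUTES-NE7.md` v3.9 §L2.10 J-1(a)
(«ONE wiring question is genuinely yours — W-LÖW-g4-1: do the functionals T.5♭ instantiates at U = 1 … read through
CO-EXACT test forms of the unit-lattice field (then covered) …») and §L2.14 J-2 («nobody should kernel B3 a second time —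
instantiate `summable_norm_diagram_sub` on the chain you hold»), `HOME/t4/b2b-balaban-t4-ne7-p2/g52/ROUTE2-NE7-P2.md`
v1.7.1 §2 T.5♭ ∕ §5 item 3, and the header of `Support/NE7LoewnerDiagramBV` (p255228) item (iii) «the position-space
chains (`MonotoneTorusPlaquette.plaqCov_antitone`, …) are to be plugged in by their users»).  HONEST FRAMING (page 1):
FIXED FINITE T⁴, rung (B)+1 = existence AND uniqueness of the `ε = L^{−K} → 0` limit of unit-scale averaged
expectations, CONDITIONAL on BetaPertH and the nine spine estimates (0/9 proved); NOT infinite volume, NOT a mass gap,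
NOT the Clay problem.  NE7 is NOT PRINTED in [Balaban1984PropagatorsI]–[Balaban1989LargeFieldII] and NOT proved here.
Everything below is [folklore] real analysis: §1 one Leibniz-type band over an ABSTRACT chain of complex matrices
(hypothesis shapes), §2–§3 the INSTANCE of `NE7LoewnerDiagramBV` §3–§4 and of §1 on a TREE OBJECT whose Löwner chain is
a TREE THEOREM with no hypothesis (`plaqCov_antitone_step`, `plaqCov_posSemidef`); no definition, no cite tag, nothing
printed asserted, no `sorry`.

WHY.  LÖW (idea-2, §L2.2) turns depth-MONOTONICITY of Bałaban's `U = 1` Gaussian constituents into two-depth moduli with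
NO RATE; B3 (`NE7LoewnerDiagramBV`, p255228) is the abstract lemma «Löwner chain of PSD kernels ⟹ every DIAGRAM functional
`Σ_x w(x)·Π_e C(x_{s(e)}, x_{t(e)})` has summable increments», with one typed instance on the momentum-fibre chain `qgq`.
The position-space object route PAIR-CAUCHY's leaf T.5♭ would read at `U = 1` — coefficients that are finite Wick∕Feynman
diagrams in the covariance of GAUGE-INVARIANT (plaquette ∕ field-strength) observables of the step-`j` fluctuation field on
the fixed unit torus — has its chain IN THE TREE, UNCONDITIONALLY: `Beta/GAN24/MonotoneTorusPlaquette` (gan24-p4) proves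
`(plaqCov R j − plaqCov R (j+1)).PosSemidef` and `(plaqCov R j).PosSemidef` for EVERY read-out torus `Tor M`, averaging
factor `Lc ≥ 1`, dimension `d`, constraint matrix `R` and level `j` (Federbush stability + (1.17) + the variational
principle; no gauge fixing, no rate, no constant, no hypothesis).  This file plugs that chain into B3 (the co-exact face of
W-LÖW-g4-1, now a theorem with NO binder) and adds the one abstract complement the β lane's (MONO-K)₂ currency suggests:
a diagram is controlled not only in total variation by the HEAD TRACE but, between any two depths, by ONE entry-deviation
datum — so `plaqCov_entry_dev_le`'s single number `η₀ ≥ re tr(plaqCov R k₀ − plaqCov R j)` bands every diagram too.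

WHAT IS PROVED ([folklore]).
§1 ABSTRACT (any finite index types): `norm_diagram_sub_le_of_entry_dev` — uniform entry bound `γ` on two kernels and an
   entry-deviation bound `η` ⟹ `‖F(C) − F(C′)‖ ≤ |E|·γ^{|E|−1}·η·‖w‖₁`; along a Löwner chain of PSD kernels from `k₀`
   (`γ = re tr P k₀` by `NE7LoewnerDiagramBV.norm_apply_le_re_trace_head`): `norm_diagram_sub_le_of_chain_dev` (two depths
   `j, j′ ≥ k₀`), **`norm_diagram_sub_lim_le_of_chain_dev`** (band to the limit value from an eventual datum).
§2 THE PLAQUETTE CHAIN, NO HYPOTHESIS: **`summable_norm_diagram_plaqCov_sub`** (every diagram in the entries of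
   `plaqCov Lc M R j` has summable increments in `j`), **`tsum_norm_diagram_plaqCov_sub_le`** (TV
   `≤ |E|·(re tr plaqCov R 0)^{|E|}·‖w‖₁`), `cauchySeq_diagram_plaqCov`, **`exists_tendsto_diagram_plaqCov`** (the
   refinement limit `j → ∞` of every plaquette diagram EXISTS), **`nullTail_re_diagram_plaqCov`** (a NULL TAIL MODULUS for
   its real part: `∃ F_∞ c, (∀ k ≤ j, |re F(plaqCov R j) − F_∞| ≤ c k) ∧ c → 0` — LITERALLY the shape of the binder
   `hconv` of `NE7PairwiseScaleShift.nullShift_of_split`, i.e. the (α) «BV in the depth» producer of ROUTE2 §2 T.5♭,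
   delivered with NO rate and NO appeal to G-an2-4's (CONV-C) for every coefficient that IS such a diagram).
§3 THE BAND FROM ONE TRACE DATUM: **`norm_diagram_plaqCov_sub_le_of_datum`** — ONE number `η₀` with
   `re tr(plaqCov R k₀ − plaqCov R j) ≤ η₀` for all `j ≥ k₀` (`plaqCov_entry_dev_le`'s datum) ⟹ for all `j, j′ ≥ k₀`,
   `‖F(plaqCov R j) − F(plaqCov R j′)‖ ≤ |E|·(re tr plaqCov R k₀)^{|E|−1}·η₀·‖w‖₁`; **`norm_diagram_plaqCov_sub_lim_le_of_datum`**
   (the same band to the limit of §2).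

HONEST LIMITS.  (i) CO-EXACT FACE ONLY: `plaqCov` reads PLAQUETTE (field-strength) observables; the harmonic ∕ pure-gauge
face of W-LÖW-g4-1 (`GAN24/MonotoneTorusHodge`, `MonotoneTorusSoft*`) is not touched, and WHICH functionals T.5♭
instantiates (B12 (2.14) p. 268 — a reading of print) is not decided here.  (ii) LÖW-res ∕ §L2.2 B4 untouched: the printed
one-loop coefficient `b₀(k)` is a background-DERIVATIVE of `½ Tr log`, not asserted to be a diagram in this chain — §2's
`nullTail_re_diagram_plaqCov` discharges `hconv` ONLY for coefficients that ARE plaquette diagrams (hypothesis displayed by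
the user, not here).  (iii) B3-vol: constants volume-EXTENSIVE (`‖w‖₁`, head trace) — fine at rung (B)+1's fixed finite
torus, not the volume-uniform 2-edge-connected∕decay refinement.  (iv) `plaqCov`'s own scope (torus avatar in B5's typing,
abelian∕linearised layer, no identification with an2's `ℤ^{d+1}` wall system) is inherited verbatim.  NOT NE7 (spine 0/9
unchanged), NOT BetaPertH, NOT summit progress.  HONEST DEPENDENCY: continuum YM on T⁴ ⇐ BetaPertH ∧ nine spine estimates
(0/9 proved); BetaPertH ⇐ (D1) ∧ (D4) ∧ CAP+tail; G-an2-4 gates asym, D1 and NE2/3/4.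
-/

noncomputable section

open Finset Filter Topology
open scoped BigOperators ComplexOrder

namespace Summit.QuantumFields.BalabanUV.T4Continuum.NE7LoewnerDiagramPlaquette

open Summit.QuantumFields.BalabanUV.T4Continuum.NE7LoewnerDiagramBV
  (diagram norm_diagram_sub_le re_trace_head_nonneg norm_apply_le_re_trace_head summable_norm_diagram_sub
    tsum_norm_diagram_sub_le nullTail_re_diagram cauchySeq_diagram exists_tendsto_diagram)

/-! ## §1 Abstract complement to B3: a diagram band from an entry-deviation datum -/

section Band

variable {ε ι n : Type*} [Fintype ε] [DecidableEq ε] [Fintype ι] [DecidableEq ι] [Fintype n]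

/-- **DIAGRAM BAND FROM AN ENTRY-DEVIATION DATUM** (one Leibniz step): if all entries of `C` and `C′` have norm `≤ γ`
(`0 ≤ γ`) and all entries of `C − C′` have norm `≤ η`, then
`‖F(C) − F(C′)‖ ≤ |E|·γ^{|E|−1}·η·Σ_x ‖w x‖` for every diagram `F = diagram src tgt w`. [folklore] -/
theorem norm_diagram_sub_le_of_entry_dev (src tgt : ε → ι) (w : (ι → n) → ℂ) {C C' : Matrix n n ℂ} {γ η : ℝ}
    (hγ : 0 ≤ γ) (hC : ∀ a b, ‖C a b‖ ≤ γ) (hC' : ∀ a b, ‖C' a b‖ ≤ γ) (hdev : ∀ a b, ‖C a b - C' a b‖ ≤ η) :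
    ‖diagram src tgt w C - diagram src tgt w C'‖ ≤
      (Fintype.card ε : ℝ) * γ ^ (Fintype.card ε - 1) * η * ∑ x : ι → n, ‖w x‖ := by
  have h := norm_diagram_sub_le src tgt w hγ hC hC'
  calc ‖diagram src tgt w C - diagram src tgt w C'‖
      ≤ γ ^ (Fintype.card ε - 1) *
          ∑ x : ι → n, ‖w x‖ * ∑ e, ‖C (x (src e)) (x (tgt e)) - C' (x (src e)) (x (tgt e))‖ := h
    _ ≤ γ ^ (Fintype.card ε - 1) * ∑ x : ι → n, ‖w x‖ * ∑ _e : ε, η := by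
        gcongr with x _ e _
        exact hdev _ _
    _ = (Fintype.card ε : ℝ) * γ ^ (Fintype.card ε - 1) * η * ∑ x : ι → n, ‖w x‖ := by
        simp only [sum_const, card_univ, nsmul_eq_mul, ← sum_mul]
        ring

variable {P : ℕ → Matrix n n ℂ} {k₀ : ℕ}

/-- **BAND BETWEEN TWO DEPTHS OF A LÖWNER CHAIN FROM AN ENTRY-DEVIATION DATUM**: along a Löwner chain of PSD kernels from
`k₀` (uniform entry bound `re tr P k₀`, `NE7LoewnerDiagramBV.norm_apply_le_re_trace_head`), if every entry of `P j − P j′`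
(`j, j′ ≥ k₀`) has norm `≤ η`, then `‖F(P j) − F(P j′)‖ ≤ |E|·(re tr P k₀)^{|E|−1}·η·Σ_x ‖w x‖`. [folklore] -/
theorem norm_diagram_sub_le_of_chain_dev (hstep : ∀ j, k₀ ≤ j → (P j - P (j + 1)).PosSemidef)
    (hpos : ∀ j, k₀ ≤ j → (P j).PosSemidef) {j j' : ℕ} (hj : k₀ ≤ j) (hj' : k₀ ≤ j') {η : ℝ}
    (hdev : ∀ a b, ‖(P j - P j') a b‖ ≤ η) (src tgt : ε → ι) (w : (ι → n) → ℂ) :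
    ‖diagram src tgt w (P j) - diagram src tgt w (P j')‖ ≤
      (Fintype.card ε : ℝ) * (P k₀).trace.re ^ (Fintype.card ε - 1) * η * ∑ x : ι → n, ‖w x‖ :=
  norm_diagram_sub_le_of_entry_dev src tgt w (re_trace_head_nonneg hpos)
    (fun a b => norm_apply_le_re_trace_head hstep hpos hj a b)
    (fun a b => norm_apply_le_re_trace_head hstep hpos hj' a b)
    (fun a b => by simpa only [Matrix.sub_apply] using hdev a b)

/-- **BAND TO THE LIMIT FROM AN EVENTUAL ENTRY-DEVIATION DATUM**: along a Löwner chain of PSD kernels from `k₀`, if from some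
depth `k₁ ≥ k₀` on every entry of `P j − P j′` (`j, j′ ≥ k₁`) has norm `≤ η`, and the diagram values converge to `F_∞`
(they always do: `NE7LoewnerDiagramBV.exists_tendsto_diagram`), then `‖F(P j) − F_∞‖ ≤ |E|·(re tr P k₀)^{|E|−1}·η·Σ_x ‖w x‖`
for every `j ≥ k₁`. [folklore] -/
theorem norm_diagram_sub_lim_le_of_chain_dev (hstep : ∀ j, k₀ ≤ j → (P j - P (j + 1)).PosSemidef)
    (hpos : ∀ j, k₀ ≤ j → (P j).PosSemidef) {k₁ : ℕ} (hk₁ : k₀ ≤ k₁) {η : ℝ}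
    (hdev : ∀ j j', k₁ ≤ j → k₁ ≤ j' → ∀ a b, ‖(P j - P j') a b‖ ≤ η) (src tgt : ε → ι) (w : (ι → n) → ℂ)
    {Finf : ℂ} (hlim : Tendsto (fun j => diagram src tgt w (P j)) atTop (𝓝 Finf)) :
    ∀ j, k₁ ≤ j → ‖diagram src tgt w (P j) - Finf‖ ≤
      (Fintype.card ε : ℝ) * (P k₀).trace.re ^ (Fintype.card ε - 1) * η * ∑ x : ι → n, ‖w x‖ := by
  intro j hj
  have hc : Tendsto (fun j' => ‖diagram src tgt w (P j) - diagram src tgt w (P j')‖) atTop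
      (𝓝 ‖diagram src tgt w (P j) - Finf‖) := (tendsto_const_nhds.sub hlim).norm
  refine le_of_tendsto hc (eventually_atTop.2 ⟨k₁, fun j' hj' => ?_⟩)
  exact norm_diagram_sub_le_of_chain_dev hstep hpos (hk₁.trans hj) (hk₁.trans hj') (hdev j j' hj hj') src tgt w

end Band

/-! ## §2 The unconditional torus plaquette-covariance chain plugged into B3 -/

section Plaquette

open Literature.MathematicalPhysics.QuantumFieldTheory.Balaban1983to89.B5Prop11Plancherel (Tor)
open Summit.QuantumFields.BalabanUV.Beta.GAN24.MonotoneTorusPlaquette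
  (plaqCov plaqCov_antitone_step plaqCov_posSemidef plaqCov_entry_dev_le)

variable {d : ℕ} (Lc : ℕ) [NeZero Lc] (M : Fin d → ℕ) [hM : ∀ μ, NeZero (M μ)]
variable {c : Type*} [Fintype c] [DecidableEq c]
variable {ε ι : Type*} [Fintype ε] [DecidableEq ε] [Fintype ι] [DecidableEq ι]

/-- **EVERY DIAGRAM IN THE PLAQUETTE COVARIANCES HAS SUMMABLE INCREMENTS UNDER REFINEMENT — NO HYPOTHESIS.**  For every
read-out torus `Tor M`, averaging factor `Lc ≥ 1`, dimension `d`, constraint matrix `R`, every finite multigraph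
`(src, tgt)` and vertex weight `w`: `j ↦ ‖F(plaqCov R j) − F(plaqCov R (j+1))‖` is summable — B3
(`NE7LoewnerDiagramBV.summable_norm_diagram_sub`) on the tree chain `plaqCov_antitone_step` ∕ `plaqCov_posSemidef`.
[folklore] -/
theorem summable_norm_diagram_plaqCov_sub (R : Matrix c (Tor M × Fin d) ℂ) (src tgt : ε → ι)
    (w : (ι → Fin d × Fin d × Tor M) → ℂ) :
    Summable fun j => ‖diagram src tgt w (plaqCov Lc M R j) - diagram src tgt w (plaqCov Lc M R (j + 1))‖ := by
  have h := summable_norm_diagram_sub (P := fun j => plaqCov Lc M R j) (k₀ := 0)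
    (fun j _ => plaqCov_antitone_step Lc M R j) (fun j _ => plaqCov_posSemidef Lc M R j) src tgt w
  exact h

/-- … with TOTAL VARIATION `≤ |E|·(re tr plaqCov R 0)^{|E|}·Σ_x ‖w x‖` (head = the coarsest level `j = 0`).
[folklore] -/
theorem tsum_norm_diagram_plaqCov_sub_le (R : Matrix c (Tor M × Fin d) ℂ) (src tgt : ε → ι)
    (w : (ι → Fin d × Fin d × Tor M) → ℂ) :
    ∑' j, ‖diagram src tgt w (plaqCov Lc M R j) - diagram src tgt w (plaqCov Lc M R (j + 1))‖ ≤
      (Fintype.card ε : ℝ) * (plaqCov Lc M R 0).trace.re ^ Fintype.card ε *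
        ∑ x : ι → Fin d × Fin d × Tor M, ‖w x‖ := by
  have h := tsum_norm_diagram_sub_le (P := fun j => plaqCov Lc M R j) (k₀ := 0)
    (fun j _ => plaqCov_antitone_step Lc M R j) (fun j _ => plaqCov_posSemidef Lc M R j) src tgt w
  exact h

/-- The values of every plaquette diagram form a CAUCHY sequence in the refinement depth. [folklore] -/
theorem cauchySeq_diagram_plaqCov (R : Matrix c (Tor M × Fin d) ℂ) (src tgt : ε → ι)
    (w : (ι → Fin d × Fin d × Tor M) → ℂ) :
    CauchySeq fun j => diagram src tgt w (plaqCov Lc M R j) := by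
  have h := cauchySeq_diagram (P := fun j => plaqCov Lc M R j) (k₀ := 0)
    (fun j _ => plaqCov_antitone_step Lc M R j) (fun j _ => plaqCov_posSemidef Lc M R j) src tgt w
  exact h

/-- **THE REFINEMENT LIMIT OF EVERY PLAQUETTE DIAGRAM EXISTS — NO HYPOTHESIS** (the lattice below the fixed read-out torus
becoming infinitely fine; existence only — no identification with a continuum object is claimed). [folklore] -/
theorem exists_tendsto_diagram_plaqCov (R : Matrix c (Tor M × Fin d) ℂ) (src tgt : ε → ι)
    (w : (ι → Fin d × Fin d × Tor M) → ℂ) :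
    ∃ Finf : ℂ, Tendsto (fun j => diagram src tgt w (plaqCov Lc M R j)) atTop (𝓝 Finf) := by
  have h := exists_tendsto_diagram (P := fun j => plaqCov Lc M R j) (k₀ := 0)
    (fun j _ => plaqCov_antitone_step Lc M R j) (fun j _ => plaqCov_posSemidef Lc M R j) src tgt w
  exact h

/-- **NULL TAIL MODULUS, NO RATE, FOR THE REAL PART OF EVERY PLAQUETTE DIAGRAM** — literally the shape of the binder
`hconv : ∀ k j, k ≤ j → |β⁰ j − β⁰_∞| ≤ c₀ k` of `NE7PairwiseScaleShift.nullShift_of_split` (ROUTE2 §2 T.5♭, producer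
(α) «BV in the depth»), discharged UNCONDITIONALLY for every coefficient sequence that IS `j ↦ re F(plaqCov R j)` (whether
Bałaban's one-loop coefficients are such diagrams is §L2.2 B4 ∕ LÖW-res — NOT claimed). [folklore] -/
theorem nullTail_re_diagram_plaqCov (R : Matrix c (Tor M × Fin d) ℂ) (src tgt : ε → ι)
    (w : (ι → Fin d × Fin d × Tor M) → ℂ) :
    ∃ Finf : ℝ, ∃ c₀ : ℕ → ℝ,
      (∀ k j, k ≤ j → |(diagram src tgt w (plaqCov Lc M R j)).re - Finf| ≤ c₀ k) ∧ Tendsto c₀ atTop (𝓝 0) := by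
  have h := nullTail_re_diagram (P := fun j => plaqCov Lc M R j) (k₀ := 0)
    (fun j _ => plaqCov_antitone_step Lc M R j) (fun j _ => plaqCov_posSemidef Lc M R j) src tgt w
  exact h

/-! ## §3 The band from ONE trace datum ((MONO-K)₂ for diagrams) -/

/-- **(MONO-K)₂ FOR PLAQUETTE DIAGRAMS FROM ONE TRACE DATUM — NO RATE.**  ONE number `η₀` with
`re tr(plaqCov R k₀ − plaqCov R j) ≤ η₀` for all `j ≥ k₀` (a computation at level `k₀` against the monotone limit —
`MonotoneTorusPlaquette.plaqCov_entry_dev_le`'s datum) bands EVERY diagram between any two depths `j, j′ ≥ k₀`: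
`‖F(plaqCov R j) − F(plaqCov R j′)‖ ≤ |E|·(re tr plaqCov R k₀)^{|E|−1}·η₀·Σ_x ‖w x‖`. [folklore] -/
theorem norm_diagram_plaqCov_sub_le_of_datum (R : Matrix c (Tor M × Fin d) ℂ) {k₀ : ℕ} {η₀ : ℝ}
    (hdat : ∀ j, k₀ ≤ j → (plaqCov Lc M R k₀ - plaqCov Lc M R j).trace.re ≤ η₀) (src tgt : ε → ι)
    (w : (ι → Fin d × Fin d × Tor M) → ℂ) :
    ∀ j j', k₀ ≤ j → k₀ ≤ j' →
      ‖diagram src tgt w (plaqCov Lc M R j) - diagram src tgt w (plaqCov Lc M R j')‖ ≤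
        (Fintype.card ε : ℝ) * (plaqCov Lc M R k₀).trace.re ^ (Fintype.card ε - 1) * η₀ *
          ∑ x : ι → Fin d × Fin d × Tor M, ‖w x‖ := by
  intro j j' hj hj'
  have hdev := (plaqCov_entry_dev_le Lc M R hdat).1 j j' hj hj'
  have h := norm_diagram_sub_le_of_chain_dev (P := fun j => plaqCov Lc M R j) (k₀ := k₀)
    (fun j _ => plaqCov_antitone_step Lc M R j) (fun j _ => plaqCov_posSemidef Lc M R j) hj hj' hdev src tgt w
  exact h

/-- … and to the refinement LIMIT `F_∞` of §2: `‖F(plaqCov R j) − F_∞‖ ≤ |E|·(re tr plaqCov R k₀)^{|E|−1}·η₀·Σ_x ‖w x‖`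
for every `j ≥ k₀`. [folklore] -/
theorem norm_diagram_plaqCov_sub_lim_le_of_datum (R : Matrix c (Tor M × Fin d) ℂ) {k₀ : ℕ} {η₀ : ℝ}
    (hdat : ∀ j, k₀ ≤ j → (plaqCov Lc M R k₀ - plaqCov Lc M R j).trace.re ≤ η₀) (src tgt : ε → ι)
    (w : (ι → Fin d × Fin d × Tor M) → ℂ) {Finf : ℂ}
    (hlim : Tendsto (fun j => diagram src tgt w (plaqCov Lc M R j)) atTop (𝓝 Finf)) :
    ∀ j, k₀ ≤ j → ‖diagram src tgt w (plaqCov Lc M R j) - Finf‖ ≤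
      (Fintype.card ε : ℝ) * (plaqCov Lc M R k₀).trace.re ^ (Fintype.card ε - 1) * η₀ *
        ∑ x : ι → Fin d × Fin d × Tor M, ‖w x‖ := by
  have h := norm_diagram_sub_lim_le_of_chain_dev (P := fun j => plaqCov Lc M R j) (k₀ := k₀)
    (fun j _ => plaqCov_antitone_step Lc M R j) (fun j _ => plaqCov_posSemidef Lc M R j) (k₁ := k₀) le_rfl
    (fun j j' hj hj' => (plaqCov_entry_dev_le Lc M R hdat).1 j j' hj hj') src tgt w hlim
  exact h

end Plaquette

/-! ## §4 (v1.1, append-only + one import) ONE TRACE DATUM, ABSTRACTLY; and the SOFT (Gaussian-weighted) constraint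
chain `MonotoneTorusSoft.softPlaqCov` plugged into B3

Bałaban's averaging constraint enters the k-step block action with a quadratic WEIGHT, not only as a hard constraint:
gan24-p4's `Beta/GAN24/MonotoneTorusSoft` types the plaquette read-out `softPlaqCov Lc M k Rs a′ Rh` of the canonical
covariance of the unit-lattice field under `2Δ_k + a′·RₛᴴRₛ` with hard rows `R_h` (no gauge fixing) and proves — for every
weight `a′ ≥ 0`, the ONLY binder below — `softPlaqCov_antitone_step` and `softPlaqCov_posSemidef` (and
`softPlaqCov_zero_weight`: `a′ = 0` is §2's `plaqCov`).  So B3 and §1 apply verbatim.  First the abstract one-datum form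
(`GAN24/MonotoneLoewner.norm_sub_apply_le_of_steps` lifted from entries to diagrams), then the instance.  Same HONEST
LIMITS as the header (co-exact face; LÖW-res ∕ B4 untouched; volume-extensive constants; `softPlaqCov`'s own scope —
torus avatar, abelian ∕ linearised layer — inherited); NOT NE7, NOT BetaPertH. -/

section Datum

open Summit.QuantumFields.BalabanUV.Beta.GAN24.MonotoneLoewner (norm_sub_apply_le_of_steps)

variable {ε ι n : Type*} [Fintype ε] [DecidableEq ε] [Fintype ι] [DecidableEq ι] [Fintype n]
variable {P : ℕ → Matrix n n ℂ} {k₀ : ℕ}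

/-- **(MONO-K)₂ FOR DIAGRAMS ALONG ANY LÖWNER CHAIN FROM ONE TRACE DATUM**: PSD steps and members from `k₀` and ONE number
`η₀ ≥ re tr(P k₀ − P j)` for all `j ≥ k₀` ⟹ for all `j, j′ ≥ k₀`,
`‖F(P j) − F(P j′)‖ ≤ |E|·(re tr P k₀)^{|E|−1}·η₀·Σ_x ‖w x‖` (entries: `MonotoneLoewner.norm_sub_apply_le_of_steps`;
diagrams: §1). [folklore] -/
theorem norm_diagram_sub_le_of_datum (hstep : ∀ j, k₀ ≤ j → (P j - P (j + 1)).PosSemidef)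
    (hpos : ∀ j, k₀ ≤ j → (P j).PosSemidef) {η₀ : ℝ} (hdat : ∀ j, k₀ ≤ j → (P k₀ - P j).trace.re ≤ η₀)
    (src tgt : ε → ι) (w : (ι → n) → ℂ) :
    ∀ j j', k₀ ≤ j → k₀ ≤ j' → ‖diagram src tgt w (P j) - diagram src tgt w (P j')‖ ≤
      (Fintype.card ε : ℝ) * (P k₀).trace.re ^ (Fintype.card ε - 1) * η₀ * ∑ x : ι → n, ‖w x‖ :=
  fun _ _ hj hj' => norm_diagram_sub_le_of_chain_dev hstep hpos hj hj'
    (norm_sub_apply_le_of_steps hstep hdat _ _ hj hj') src tgt w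

/-- … and to the limit value `F_∞` of the diagram along the chain (which exists, `NE7LoewnerDiagramBV.exists_tendsto_diagram`):
`‖F(P j) − F_∞‖ ≤ |E|·(re tr P k₀)^{|E|−1}·η₀·Σ_x ‖w x‖` for every `j ≥ k₀`. [folklore] -/
theorem norm_diagram_sub_lim_le_of_datum (hstep : ∀ j, k₀ ≤ j → (P j - P (j + 1)).PosSemidef)
    (hpos : ∀ j, k₀ ≤ j → (P j).PosSemidef) {η₀ : ℝ} (hdat : ∀ j, k₀ ≤ j → (P k₀ - P j).trace.re ≤ η₀)
    (src tgt : ε → ι) (w : (ι → n) → ℂ) {Finf : ℂ}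
    (hlim : Tendsto (fun j => diagram src tgt w (P j)) atTop (𝓝 Finf)) :
    ∀ j, k₀ ≤ j → ‖diagram src tgt w (P j) - Finf‖ ≤
      (Fintype.card ε : ℝ) * (P k₀).trace.re ^ (Fintype.card ε - 1) * η₀ * ∑ x : ι → n, ‖w x‖ :=
  norm_diagram_sub_lim_le_of_chain_dev hstep hpos (k₁ := k₀) le_rfl
    (fun _ _ hj hj' => norm_sub_apply_le_of_steps hstep hdat _ _ hj hj') src tgt w hlim

end Datum

section Soft

open Literature.MathematicalPhysics.QuantumFieldTheory.Balaban1983to89.B5Prop11Plancherel (Tor)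
open Summit.QuantumFields.BalabanUV.Beta.GAN24.MonotoneTorusSoft
  (softPlaqCov softPlaqCov_antitone_step softPlaqCov_posSemidef)

variable {d : ℕ} (Lc : ℕ) [NeZero Lc] (M : Fin d → ℕ) [hM : ∀ μ, NeZero (M μ)]
variable {cs : Type*} [Fintype cs] {ch : Type*} [Fintype ch] [DecidableEq ch]
variable {ε ι : Type*} [Fintype ε] [DecidableEq ε] [Fintype ι] [DecidableEq ι]

/-- **EVERY DIAGRAM IN THE SOFT PLAQUETTE COVARIANCES HAS SUMMABLE INCREMENTS IN THE STEP `k`** — for every weight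
`a′ ≥ 0`, soft rows `Rₛ`, hard rows `R_h`, read-out torus, `Lc ≥ 1`, `d`: B3 on the tree chain
`softPlaqCov_antitone_step` ∕ `softPlaqCov_posSemidef`. [folklore] -/
theorem summable_norm_diagram_softPlaqCov_sub (Rs : Matrix cs (Tor M × Fin d) ℂ) {a' : ℝ} (ha' : 0 ≤ a')
    (Rh : Matrix ch (Tor M × Fin d) ℂ) (src tgt : ε → ι) (w : (ι → Fin d × Fin d × Tor M) → ℂ) :
    Summable fun k => ‖diagram src tgt w (softPlaqCov Lc M k Rs a' Rh) -
      diagram src tgt w (softPlaqCov Lc M (k + 1) Rs a' Rh)‖ := by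
  have h := summable_norm_diagram_sub (P := fun k => softPlaqCov Lc M k Rs a' Rh) (k₀ := 0)
    (fun k _ => softPlaqCov_antitone_step Lc M k Rs ha' Rh) (fun k _ => softPlaqCov_posSemidef Lc M k Rs ha' Rh)
    src tgt w
  exact h

/-- … with TOTAL VARIATION `≤ |E|·(re tr softPlaqCov 0 Rₛ a′ R_h)^{|E|}·Σ_x ‖w x‖`. [folklore] -/
theorem tsum_norm_diagram_softPlaqCov_sub_le (Rs : Matrix cs (Tor M × Fin d) ℂ) {a' : ℝ} (ha' : 0 ≤ a')
    (Rh : Matrix ch (Tor M × Fin d) ℂ) (src tgt : ε → ι) (w : (ι → Fin d × Fin d × Tor M) → ℂ) :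
    ∑' k, ‖diagram src tgt w (softPlaqCov Lc M k Rs a' Rh) - diagram src tgt w (softPlaqCov Lc M (k + 1) Rs a' Rh)‖ ≤
      (Fintype.card ε : ℝ) * (softPlaqCov Lc M 0 Rs a' Rh).trace.re ^ Fintype.card ε *
        ∑ x : ι → Fin d × Fin d × Tor M, ‖w x‖ := by
  have h := tsum_norm_diagram_sub_le (P := fun k => softPlaqCov Lc M k Rs a' Rh) (k₀ := 0)
    (fun k _ => softPlaqCov_antitone_step Lc M k Rs ha' Rh) (fun k _ => softPlaqCov_posSemidef Lc M k Rs ha' Rh)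
    src tgt w
  exact h

/-- **THE LIMIT `k → ∞` OF EVERY SOFT PLAQUETTE DIAGRAM EXISTS** (for every `a′ ≥ 0`; existence only). [folklore] -/
theorem exists_tendsto_diagram_softPlaqCov (Rs : Matrix cs (Tor M × Fin d) ℂ) {a' : ℝ} (ha' : 0 ≤ a')
    (Rh : Matrix ch (Tor M × Fin d) ℂ) (src tgt : ε → ι) (w : (ι → Fin d × Fin d × Tor M) → ℂ) :
    ∃ Finf : ℂ, Tendsto (fun k => diagram src tgt w (softPlaqCov Lc M k Rs a' Rh)) atTop (𝓝 Finf) := by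
  have h := exists_tendsto_diagram (P := fun k => softPlaqCov Lc M k Rs a' Rh) (k₀ := 0)
    (fun k _ => softPlaqCov_antitone_step Lc M k Rs ha' Rh) (fun k _ => softPlaqCov_posSemidef Lc M k Rs ha' Rh)
    src tgt w
  exact h

/-- **NULL TAIL MODULUS, NO RATE, for the real part of every soft plaquette diagram** (the `hconv` shape of
`NE7PairwiseScaleShift.nullShift_of_split`, as in §2, now for the Gaussian-weighted constraint). [folklore] -/
theorem nullTail_re_diagram_softPlaqCov (Rs : Matrix cs (Tor M × Fin d) ℂ) {a' : ℝ} (ha' : 0 ≤ a')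
    (Rh : Matrix ch (Tor M × Fin d) ℂ) (src tgt : ε → ι) (w : (ι → Fin d × Fin d × Tor M) → ℂ) :
    ∃ Finf : ℝ, ∃ c₀ : ℕ → ℝ,
      (∀ k j, k ≤ j → |(diagram src tgt w (softPlaqCov Lc M j Rs a' Rh)).re - Finf| ≤ c₀ k) ∧
        Tendsto c₀ atTop (𝓝 0) := by
  have h := nullTail_re_diagram (P := fun k => softPlaqCov Lc M k Rs a' Rh) (k₀ := 0)
    (fun k _ => softPlaqCov_antitone_step Lc M k Rs ha' Rh) (fun k _ => softPlaqCov_posSemidef Lc M k Rs ha' Rh)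
    src tgt w
  exact h

/-- **(MONO-K)₂ FOR SOFT PLAQUETTE DIAGRAMS FROM ONE TRACE DATUM — NO RATE**: ONE number `η₀` with
`re tr(softPlaqCov k₀ − softPlaqCov j) ≤ η₀` for all `j ≥ k₀` bands every diagram between two depths `≥ k₀` by
`|E|·(re tr softPlaqCov k₀)^{|E|−1}·η₀·Σ_x ‖w x‖`. [folklore] -/
theorem norm_diagram_softPlaqCov_sub_le_of_datum (Rs : Matrix cs (Tor M × Fin d) ℂ) {a' : ℝ} (ha' : 0 ≤ a')
    (Rh : Matrix ch (Tor M × Fin d) ℂ) {k₀ : ℕ} {η₀ : ℝ}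
    (hdat : ∀ j, k₀ ≤ j → (softPlaqCov Lc M k₀ Rs a' Rh - softPlaqCov Lc M j Rs a' Rh).trace.re ≤ η₀)
    (src tgt : ε → ι) (w : (ι → Fin d × Fin d × Tor M) → ℂ) :
    ∀ j j', k₀ ≤ j → k₀ ≤ j' →
      ‖diagram src tgt w (softPlaqCov Lc M j Rs a' Rh) - diagram src tgt w (softPlaqCov Lc M j' Rs a' Rh)‖ ≤
        (Fintype.card ε : ℝ) * (softPlaqCov Lc M k₀ Rs a' Rh).trace.re ^ (Fintype.card ε - 1) * η₀ *
          ∑ x : ι → Fin d × Fin d × Tor M, ‖w x‖ := by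
  have h := norm_diagram_sub_le_of_datum (P := fun k => softPlaqCov Lc M k Rs a' Rh) (k₀ := k₀)
    (fun k _ => softPlaqCov_antitone_step Lc M k Rs ha' Rh) (fun k _ => softPlaqCov_posSemidef Lc M k Rs ha' Rh)
    hdat src tgt w
  exact h

/-- … and the same band to the limit `F_∞` of `exists_tendsto_diagram_softPlaqCov`, for every `j ≥ k₀`. [folklore] -/
theorem norm_diagram_softPlaqCov_sub_lim_le_of_datum (Rs : Matrix cs (Tor M × Fin d) ℂ) {a' : ℝ} (ha' : 0 ≤ a')
    (Rh : Matrix ch (Tor M × Fin d) ℂ) {k₀ : ℕ} {η₀ : ℝ}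
    (hdat : ∀ j, k₀ ≤ j → (softPlaqCov Lc M k₀ Rs a' Rh - softPlaqCov Lc M j Rs a' Rh).trace.re ≤ η₀)
    (src tgt : ε → ι) (w : (ι → Fin d × Fin d × Tor M) → ℂ) {Finf : ℂ}
    (hlim : Tendsto (fun k => diagram src tgt w (softPlaqCov Lc M k Rs a' Rh)) atTop (𝓝 Finf)) :
    ∀ j, k₀ ≤ j → ‖diagram src tgt w (softPlaqCov Lc M j Rs a' Rh) - Finf‖ ≤
      (Fintype.card ε : ℝ) * (softPlaqCov Lc M k₀ Rs a' Rh).trace.re ^ (Fintype.card ε - 1) * η₀ *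
        ∑ x : ι → Fin d × Fin d × Tor M, ‖w x‖ := by
  have h := norm_diagram_sub_lim_le_of_datum (P := fun k => softPlaqCov Lc M k Rs a' Rh) (k₀ := k₀)
    (fun k _ => softPlaqCov_antitone_step Lc M k Rs ha' Rh) (fun k _ => softPlaqCov_posSemidef Lc M k Rs ha' Rh)
    hdat src tgt w hlim
  exact h

end Soft

end Summit.QuantumFields.BalabanUV.T4Continuum.NE7LoewnerDiagramPlaquette

end
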